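import Literature.AnabelianGeometry.EtaleTheta.Discharge.Sec2DtpYThetaAbelian
import Literature.Topology.FourManifolds.SurfaceGroupNotProjective
import HarnessLib

/-!
# [EtTh] §1 p. 12: "`Δ_Θ (≅ Ẑ(1))`" is TORSION-FREE — PROVED from the root axioms of the theta setting
# (proof-only; discharges the `2`-torsion binder `H2` of the §2 rigidity chain at every single level)

Mochizuki, *The étale theta function and its Frobenioid-theoretic manifestations*, Publ. RIMS **45**
(2009) [EtTh], §1, PRIMS PDF p. 12 (printed 238): "`1 → ∧² Δ^ell_X (≅ Ẑ(1)) → Δ^Θ_X → Δ^ell_X → 1` …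
`(Ẑ(1) ≅) Δ_Θ ⊆ Δ^Θ_X`" [cite: MochizukiEtTh2009, §1 p.12]. Layer L2 of the abc-iut cell, seat
abc-iut-L2-t8 (gen 2), PROOF-ONLY companion of `Setting.lean` (seat abc-iut-L2-t1); nothing of another
seat is edited or restated.

WHAT IS PROVED. For `D : ThetaSetting p` with the vacuity guard `D.IsEtThOrigin` ("`Δ_X` is a profinite
free group on 2 generators"), writing `Δ_X = D.DeltaHat`, `K₂ = [Δ_X,Δ_X]⁻`, `K₃ = [[Δ_X,Δ_X],Δ_X]⁻`:
* `ThetaSetting.mem_tripleCommutatorClosure_of_pow_mem` — `K₂/K₃` is torsion-free: `c ∈ K₂`, `n ≥ 1`,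
  `c^n ∈ K₃ ⇒ c ∈ K₃`;
* `ThetaSetting.deltaTheta_torsionfree` — the (tempered) `Δ_Θ = Ker((Π^tp_X)^Θ ↠ (Π^tp_X)^ell)` is
  torsion-free: `t ∈ Δ_Θ`, `t^n = 1`, `n ≥ 1 ⇒ t = 1`;
* `ThetaSetting.CyclotomeMod.red_eq_one_of_sq_eq_one_of_origin` — the `2`-torsion hypothesis `H2` of
  `Discharge/Sec2GalExtensionProofs.lean` (seat abc-iut-L2-t10: "`∀ t : l·Δ_Θ, t² = 1 → red t = 1`",
  there flagged as not following from `Setting` v3 + `CyclotomeMod`) HOLDS for EVERY single-level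
  cyclotome under the guard (the guard is what excludes the `2`-torsion).

PROOF (finite Heisenberg quotients). (1) SEPARATION (`DtpYAbelian.mem_of_forall_mem_sup`): fix an open
normal `U ≤ Π_X`, `M' := K₃ ⊔ U`, `N₀ := #(Π_X/M')`. (2) From freeness, a continuous `F : Δ_X → H(ℤ/nN₀)`
onto the standard generators `x, y` of the Heisenberg group (a cocycle extension of `(ℤ/nN₀)²` by
`ℤ/nN₀`, as in `Sec2ThetaGroupHcomm.lean`) with `[x, y]` of order `nN₀`; `F` kills `K₃`. (3) With
`Φ := (mod M', F) : Δ_X → Π_X/M' × H`, the image `A = Φ(Δ_X)` is generated by `Φ a, Φ b` (generation of `Δ_X`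
by the free pair modulo the open kernel, uniqueness clause of `IsFreeProfiniteOnTwo`) and has class two,
so `[A, A]` is the cyclic group on `γ = [Φ a, Φ b] = ([ā, b̄], [x, y])` (Witt–Hall normal forms,
`Sec2ClassTwoNormalForms.lean`); `Φ(K₂) ⊆ [A, A]` (closedness). (4) Hence `Φ c = γ^e`; `c^n ∈ K₃` gives
`[x,y]^{en} = 1`, so `nN₀ ∣ en`, `N₀ ∣ e`, and `c ≡ [ā,b̄]^e ≡ 1 mod M'`. HONEST FRAMING: [EtTh] is
refereed; the theta setting is data quoting print, not asserted to exist; OUR kernel check of a shadow of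
the printed "`Δ_Θ ≅ Ẑ(1)`" (torsion-freeness only — procyclicity and the Galois action are NOT claimed);
no side is taken on any disputed claim.
-/

noncomputable section

namespace Literature.AnabelianGeometry.EtaleTheta

open Literature.AnabelianGeometry.SemiGraphs Literature.Algebra.Homology Literature.Topology.FourManifolds
open _root_.Topology
open scoped commutatorElement
open ClassTwo DtpYAbelian groupCohomology

/-! ### Generic group theory -/

namespace DtpYAbelian

section Algebra

variable {G : Type*} [Group G]

/-- `[A, A] ≤ A` for any subgroup `A`. [cite: MagnusKarrassSolitar1966, Thm 5.1 §5.2 p.290] -/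
theorem commutator_le_self (A : Subgroup G) : ⁅A, A⁆ ≤ A :=
  Subgroup.commutator_le.mpr fun x hx y hy => by
    rw [commutatorElement_def]
    exact A.mul_mem (A.mul_mem (A.mul_mem hx hy) (A.inv_mem hx)) (A.inv_mem hy)

/-- **In a class-two group generated by two elements the commutator subgroup is cyclic**: if
`A ≤ ⟨α, β⟩` with `α, β ∈ A` and `[[A, A], A] = 1`, then `[A, A]` lies in the cyclic group on `[α, β]`
(Witt–Hall normal forms). [cite: MagnusKarrassSolitar1966, Thm 5.1 §5.2 p.290] -/
theorem commutator_le_zpowers_of_classTwo (A : Subgroup G) {α β : G} (hα : α ∈ A) (hβ : β ∈ A)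
    (hgen : A ≤ Subgroup.closure ({α, β} : Set G)) (h3 : ⁅⁅A, A⁆, A⁆ = ⊥) :
    ⁅A, A⁆ ≤ Subgroup.zpowers (⁅α, β⁆ : G) := by
  have hK₂A : ⁅A, A⁆ ≤ A := commutator_le_self A
  have hAK : ⁅A, ⁅A, A⁆⁆ ≤ (⊥ : Subgroup G) := by rw [Subgroup.commutator_comm, h3]
  refine Subgroup.commutator_le.mpr fun h₁ hh₁ h₂ hh₂ => ?_
  obtain ⟨i, j, c, hc, rfl⟩ := exists_normalForm_of_mem_closure_pair A hα hβ (hgen hh₁)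
  obtain ⟨i', j', c', hc', rfl⟩ := exists_normalForm_of_mem_closure_pair A hα hβ (hgen hh₂)
  have key := mk_commutator_normalForm A ⁅A, A⁆ ⊥ le_rfl hK₂A hAK hα hβ hc hc' i j i' j'
  rw [← QuotientGroup.mk_zpow, QuotientGroup.eq, Subgroup.mem_bot, inv_mul_eq_one] at key
  rw [key]
  exact Subgroup.zpow_mem_zpowers _ _

end Algebra

section Profinite

/-- **The free pair meets every coset of an open normal subgroup** (uniqueness clause of the freeness
universal property against the finite discrete quotient `P/W` and the subgroup generated by the images
of `a, b` in it): every `x ∈ P` is `s · w` with `s ∈ ⟨a, b⟩`, `w ∈ W`.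
[cite: MochizukiEtTh2009, §1 p.12] -/
theorem exists_mem_closure_pair_inv_mul_mem {P : Type} [Group P] [TopologicalSpace P]
    [IsTopologicalGroup P] [CompactSpace P] {a b : P}
    (huniv : ∀ (Q : Type) [Group Q] [Finite Q] [TopologicalSpace Q] [DiscreteTopology Q] (x y : Q),
      ∃! f : P →ₜ* Q, f a = x ∧ f b = y)
    (W : Subgroup P) [W.Normal] (hW : IsOpen (W : Set P)) (x : P) :
    ∃ s ∈ Subgroup.closure ({a, b} : Set P), s⁻¹ * x ∈ W := by
  haveI : DiscreteTopology (P ⧸ W) := QuotientGroup.discreteTopology hW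
  haveI : Finite (P ⧸ W) := Subgroup.quotient_finite_of_isOpen W hW
  let π : P →ₜ* P ⧸ W :=
    { toMonoidHom := QuotientGroup.mk' W, continuous_toFun := QuotientGroup.continuous_mk }
  let H : Subgroup (P ⧸ W) := Subgroup.closure ({π a, π b} : Set (P ⧸ W))
  have haH : π a ∈ H := Subgroup.subset_closure (Set.mem_insert _ _)
  have hbH : π b ∈ H := Subgroup.subset_closure (Set.mem_insert_of_mem _ (Set.mem_singleton _))
  obtain ⟨f, ⟨hfa, hfb⟩, -⟩ := huniv H ⟨π a, haH⟩ ⟨π b, hbH⟩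
  obtain ⟨g₀, -, hg₀⟩ := huniv (P ⧸ W) (π a) (π b)
  let g₁ : P →ₜ* P ⧸ W :=
    { toMonoidHom := H.subtype.comp f.toMonoidHom
      continuous_toFun := continuous_subtype_val.comp f.continuous_toFun }
  have h1 : g₁ = g₀ := by
    refine hg₀ g₁ ⟨?_, ?_⟩
    · change (f a : P ⧸ W) = π a
      rw [hfa]
    · change (f b : P ⧸ W) = π b
      rw [hfb]
  have h2 : π = g₀ := hg₀ π ⟨rfl, rfl⟩
  have hπH : π x ∈ H := by
    have hx : π x = g₁ x := by rw [h1, ← h2]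
    rw [hx]
    exact (f x).2
  have hHeq : H = (Subgroup.closure ({a, b} : Set P)).map (QuotientGroup.mk' W) := by
    rw [MonoidHom.map_closure, Set.image_pair]
    rfl
  rw [hHeq] at hπH
  obtain ⟨s, hs, hsx⟩ := hπH
  refine ⟨s, hs, ?_⟩
  rw [← QuotientGroup.eq]
  exact hsx

end Profinite

end DtpYAbelian

/-! ### The theta setting: `K₂/K₃` and `Δ_Θ` are torsion-free -/

namespace ThetaSetting

open DtpYAbelian

variable {p : ℕ} [Fact p.Prime] (D : ThetaSetting p)

/-- **`[Δ_X,Δ_X]⁻/[[Δ_X,Δ_X],Δ_X]⁻` is torsion-free** ("`∧² Δ^ell_X (≅ Ẑ(1))`", p. 12) — from the root axioms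
and the freeness guard: if `c ∈ [Δ_X,Δ_X]⁻` and `c^n ∈ [[Δ_X,Δ_X],Δ_X]⁻` for some `n ≥ 1`, then
`c ∈ [[Δ_X,Δ_X],Δ_X]⁻`. See the module docstring for the proof (finite Heisenberg quotients).
[cite: MochizukiEtTh2009, §1 p.12] -/
theorem mem_tripleCommutatorClosure_of_pow_mem (hO : D.IsEtThOrigin) {c : D.PiHat}
    (hc : c ∈ (⁅D.DeltaHat, D.DeltaHat⁆).topologicalClosure) {n : ℕ} (hn : n ≠ 0)
    (hcn : c ^ n ∈ (⁅⁅D.DeltaHat, D.DeltaHat⁆, D.DeltaHat⁆).topologicalClosure) :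
    c ∈ (⁅⁅D.DeltaHat, D.DeltaHat⁆, D.DeltaHat⁆).topologicalClosure := by
  classical
  haveI : CompactSpace D.PiHat := D.isProfiniteCompletion_toHat.compactSpace
  haveI : TotallyDisconnectedSpace D.PiHat := D.isProfiniteCompletion_toHat.totallyDisconnectedSpace
  haveI hΔn : D.DeltaHat.Normal := SettingCompletion.deltaHat_normal D.toTemperedCurve
  haveI hK₃n : (⁅⁅D.DeltaHat, D.DeltaHat⁆, D.DeltaHat⁆).topologicalClosure.Normal :=
    Subgroup.is_normal_topologicalClosure _
  have hK₃closed : IsClosed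
      (((⁅⁅D.DeltaHat, D.DeltaHat⁆, D.DeltaHat⁆).topologicalClosure : Subgroup D.PiHat) :
        Set D.PiHat) :=
    Subgroup.isClosed_topologicalClosure _
  have hΔclosed : IsClosed (D.DeltaHat : Set D.PiHat) := Subgroup.isClosed_topologicalClosure _
  have hcΔ : c ∈ D.DeltaHat := D.commutatorClosure_le_deltaHat hc
  -- the free pair
  obtain ⟨hcpt, _, _, a, b, huniv⟩ := hO.deltaHat_free
  haveI : CompactSpace D.DeltaHat := hcpt
  -- commutator subgroups of the subgroup type `↥Δ_X` versus those of `Δ_X ≤ Π_X`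
  have hmapTop : (⊤ : Subgroup D.DeltaHat).map D.DeltaHat.subtype = D.DeltaHat := by
    rw [← MonoidHom.range_eq_map, Subgroup.range_subtype]
  have hmap2 : (⁅(⊤ : Subgroup D.DeltaHat), (⊤ : Subgroup D.DeltaHat)⁆ : Subgroup D.DeltaHat).map D.DeltaHat.subtype =
      ⁅D.DeltaHat, D.DeltaHat⁆ := by
    rw [Subgroup.map_commutator, hmapTop]
  have hmap3 : (⁅⁅(⊤ : Subgroup D.DeltaHat), (⊤ : Subgroup D.DeltaHat)⁆, (⊤ : Subgroup D.DeltaHat)⁆ : Subgroup D.DeltaHat).map D.DeltaHat.subtype =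
      ⁅⁅D.DeltaHat, D.DeltaHat⁆, D.DeltaHat⁆ := by
    rw [Subgroup.map_commutator, hmap2, hmapTop]
  -- (1) separation
  refine mem_of_forall_mem_sup _ hK₃closed fun U => ?_
  let M' : Subgroup D.PiHat :=
    (⁅⁅D.DeltaHat, D.DeltaHat⁆, D.DeltaHat⁆).topologicalClosure ⊔ U.toSubgroup
  haveI hM'n : M'.Normal := inferInstance
  have hM'o : IsOpen (M' : Set D.PiHat) :=
    Subgroup.isOpen_mono (le_sup_right : U.toSubgroup ≤ M') U.toOpenSubgroup.isOpen
  haveI : Finite (D.PiHat ⧸ M') := Subgroup.quotient_finite_of_isOpen M' hM'o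
  haveI : DiscreteTopology (D.PiHat ⧸ M') := QuotientGroup.discreteTopology hM'o
  have hN₀ : Nat.card (D.PiHat ⧸ M') ≠ 0 := Nat.card_pos.ne'
  -- (2) the finite Heisenberg group `H(ℤ/m)`, `m = n · #(Π_X/M')`, as a cocycle extension
  haveI : NeZero (n * Nat.card (D.PiHat ⧸ M')) := ⟨mul_ne_zero hn hN₀⟩
  let B : (ZMod (n * Nat.card (D.PiHat ⧸ M')) × ZMod (n * Nat.card (D.PiHat ⧸ M'))) →+
      (ZMod (n * Nat.card (D.PiHat ⧸ M')) × ZMod (n * Nat.card (D.PiHat ⧸ M'))) →+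
        ZMod (n * Nat.card (D.PiHat ⧸ M')) :=
    { toFun := fun v =>
        { toFun := fun w => v.1 * w.2
          map_zero' := by simp
          map_add' := fun w w' => by simp only [Prod.snd_add, mul_add] }
      map_zero' := AddMonoidHom.ext fun w => by simp
      map_add' := fun v v' => AddMonoidHom.ext fun w => by
        simp only [AddMonoidHom.coe_mk, ZeroHom.coe_mk, AddMonoidHom.add_apply, Prod.fst_add,
          add_mul] }
  obtain ⟨f, hf⟩ := exists_cocycles₂_of_biadditive B
  haveI : Finite (Rep.trivial (ZMod (n * Nat.card (D.PiHat ⧸ M')))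
      (Multiplicative (ZMod (n * Nat.card (D.PiHat ⧸ M')) × ZMod (n * Nat.card (D.PiHat ⧸ M'))))
      (ZMod (n * Nat.card (D.PiHat ⧸ M')))) :=
    inferInstanceAs (Finite (ZMod (n * Nat.card (D.PiHat ⧸ M'))))
  letI : TopologicalSpace (CocycleExtension f) := ⊥
  haveI : DiscreteTopology (CocycleExtension f) := ⟨rfl⟩
  let x : CocycleExtension f := ⟨0, Multiplicative.ofAdd (1, 0)⟩
  let y : CocycleExtension f := ⟨0, Multiplicative.ofAdd (0, 1)⟩
  -- commutators in `E_f` are central, and `[x, y]` has order `m`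
  have hQ1 : ∀ q ∈ (⁅(⊤ : Subgroup (CocycleExtension f)), (⊤ : Subgroup (CocycleExtension f))⁆ :
      Subgroup (CocycleExtension f)), ∃ c, q = CocycleExtension.inl f c := by
    intro q hq
    have hle : (⁅(⊤ : Subgroup (CocycleExtension f)), (⊤ : Subgroup (CocycleExtension f))⁆ :
        Subgroup (CocycleExtension f)) ≤ (CocycleExtension.rightHom f).ker := by
      rw [← commutator_def]
      exact Abelianization.commutator_subset_ker _
    have hq' := hle hq
    rw [← CocycleExtension.range_inl_eq_ker_rightHom] at hq'
    obtain ⟨c, hc⟩ := hq'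
    exact ⟨c, hc.symm⟩
  have hcentral : ∀ (c) (q : CocycleExtension f), Commute (CocycleExtension.inl f c) q := by
    intro c q
    have h := CocycleExtension.mul_inl_mul_inv f q c.toAdd
    rw [Rep.trivial_ρ_apply, ofAdd_toAdd] at h
    exact (mul_inv_eq_iff_eq_mul.mp h).symm
  have hQ3 : ∀ q ∈ (⁅⁅(⊤ : Subgroup (CocycleExtension f)), (⊤ : Subgroup (CocycleExtension f))⁆,
      (⊤ : Subgroup (CocycleExtension f))⁆ : Subgroup (CocycleExtension f)), q = 1 := by
    have hle : (⁅⁅(⊤ : Subgroup (CocycleExtension f)), (⊤ : Subgroup (CocycleExtension f))⁆,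
        (⊤ : Subgroup (CocycleExtension f))⁆ : Subgroup (CocycleExtension f)) ≤ ⊥ := by
      refine Subgroup.commutator_le.mpr fun c hc q _ => ?_
      obtain ⟨c₀, rfl⟩ := hQ1 c hc
      rw [Subgroup.mem_bot, commutatorElement_eq_one_iff_commute]
      exact hcentral c₀ q
    exact fun q hq => (Subgroup.mem_bot).mp (hle hq)
  have horder : orderOf (⁅x, y⁆ : CocycleExtension f) = n * Nat.card (D.PiHat ⧸ M') := by
    rw [commutatorElement_def,
      CocycleExtension.commutator_eq_inl_of_trivial f _ _ (Commute.all _ _), hf, hf]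
    simp only [x, y, toAdd_ofAdd, B, AddMonoidHom.coe_mk, ZeroHom.coe_mk, mul_one, mul_zero, sub_zero]
    rw [orderOf_injective _ (CocycleExtension.inl_injective f), orderOf_ofAdd_eq_addOrderOf,
      ZMod.addOrderOf_one]
  -- the continuous homomorphism `F : Δ_X → E_f` with `F a = x`, `F b = y`
  obtain ⟨F, ⟨hFa, hFb⟩, -⟩ := huniv (CocycleExtension f) x y
  -- (3) `Φ = (mod M', F) : Δ_X → Π_X/M' × E_f`
  let π : D.DeltaHat →* D.PiHat ⧸ M' := (QuotientGroup.mk' M').comp D.DeltaHat.subtype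
  let Φ : D.DeltaHat →* (D.PiHat ⧸ M') × CocycleExtension f := π.prod F.toMonoidHom
  have hΦc : Continuous Φ :=
    (QuotientGroup.continuous_mk.comp continuous_subtype_val).prodMk F.continuous_toFun
  have hΦ_fst : ∀ q : D.DeltaHat, (Φ q).1 = QuotientGroup.mk' M' (q : D.PiHat) := fun q => rfl
  have hΦ_snd : ∀ q : D.DeltaHat, (Φ q).2 = F q := fun q => rfl
  have hfst : ∀ (q : (D.PiHat ⧸ M') × CocycleExtension f) (k : ℤ), (q ^ k).1 = q.1 ^ k :=
    fun q k => map_zpow (MonoidHom.fst _ _) q k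
  have hsnd : ∀ (q : (D.PiHat ⧸ M') × CocycleExtension f) (k : ℤ), (q ^ k).2 = q.2 ^ k :=
    fun q k => map_zpow (MonoidHom.snd _ _) q k
  have hcomm_fst : ∀ u v : (D.PiHat ⧸ M') × CocycleExtension f, (⁅u, v⁆).1 = ⁅u.1, v.1⁆ :=
    fun u v => map_commutatorElement (MonoidHom.fst _ _) u v
  have hcomm_snd : ∀ u v : (D.PiHat ⧸ M') × CocycleExtension f, (⁅u, v⁆).2 = ⁅u.2, v.2⁆ :=
    fun u v => map_commutatorElement (MonoidHom.snd _ _) u v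
  let A : Subgroup ((D.PiHat ⧸ M') × CocycleExtension f) := Φ.range
  -- `Φ` kills `[[Δ_X,Δ_X],Δ_X]` (both components do), so `A` has class two
  have hker3 : ∀ q : D.DeltaHat, (q : D.PiHat) ∈ ⁅⁅D.DeltaHat, D.DeltaHat⁆, D.DeltaHat⁆ → Φ q = 1 := by
    intro q hq
    have hq' : q ∈ (⁅⁅(⊤ : Subgroup D.DeltaHat), (⊤ : Subgroup D.DeltaHat)⁆, (⊤ : Subgroup D.DeltaHat)⁆ : Subgroup D.DeltaHat) := by
      rw [← hmap3] at hq
      obtain ⟨q', hq', hqq'⟩ := hq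
      rwa [← D.DeltaHat.subtype_injective hqq']
    refine Prod.ext ?_ ?_
    · rw [hΦ_fst, Prod.fst_one, QuotientGroup.mk'_apply, QuotientGroup.eq_one_iff]
      exact Subgroup.mem_sup_left (Subgroup.le_topologicalClosure _ hq)
    · rw [hΦ_snd, Prod.snd_one]
      refine hQ3 _ ?_
      have h := Subgroup.mem_map_of_mem F.toMonoidHom hq'
      rw [Subgroup.map_commutator, Subgroup.map_commutator] at h
      exact Subgroup.commutator_mono (Subgroup.commutator_mono le_top le_top) le_top h
  have h3 : ⁅⁅A, A⁆, A⁆ = ⊥ := by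
    have hA : A = (⊤ : Subgroup D.DeltaHat).map Φ := MonoidHom.range_eq_map Φ
    rw [hA, ← Subgroup.map_commutator, ← Subgroup.map_commutator, eq_bot_iff]
    rintro _ ⟨q, hq, rfl⟩
    rw [Subgroup.mem_bot]
    refine hker3 q ?_
    rw [← hmap3]
    exact Subgroup.mem_map_of_mem _ hq
  -- `A` is generated by `Φ a`, `Φ b` (freeness: generation modulo the open kernel of `Φ`)
  have hkero : IsOpen ((Φ.ker : Subgroup D.DeltaHat) : Set D.DeltaHat) := by
    have : ((Φ.ker : Subgroup D.DeltaHat) : Set D.DeltaHat) = Φ ⁻¹' {1} := by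
      ext q; simp [MonoidHom.mem_ker]
    rw [this]
    exact (isOpen_discrete _).preimage hΦc
  have hgen : A ≤ Subgroup.closure ({Φ a, Φ b} : Set ((D.PiHat ⧸ M') × CocycleExtension f)) := by
    rintro _ ⟨q, rfl⟩
    obtain ⟨s, hs, hsq⟩ := exists_mem_closure_pair_inv_mul_mem huniv Φ.ker hkero q
    have hΦq : Φ q = Φ s := by
      rw [MonoidHom.mem_ker, map_mul, map_inv, inv_mul_eq_one] at hsq
      exact hsq.symm
    rw [hΦq]
    have h := Subgroup.mem_map_of_mem Φ hs
    rwa [MonoidHom.map_closure, Set.image_pair] at h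
  have hαA : Φ a ∈ A := ⟨a, rfl⟩
  have hβA : Φ b ∈ A := ⟨b, rfl⟩
  have hcyc : ⁅A, A⁆ ≤ Subgroup.zpowers (⁅Φ a, Φ b⁆ : (D.PiHat ⧸ M') × CocycleExtension f) :=
    commutator_le_zpowers_of_classTwo A hαA hβA hgen h3
  -- `Φ` carries `[Δ_X,Δ_X]⁻` into `[A, A]` (closedness of the preimage)
  have hcA : Φ ⟨c, hcΔ⟩ ∈ ⁅A, A⁆ := by
    have hle : (⁅D.DeltaHat, D.DeltaHat⁆).topologicalClosure ≤
        ((⁅A, A⁆.comap Φ).map D.DeltaHat.subtype : Subgroup D.PiHat) := by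
      refine Subgroup.topologicalClosure_minimal _ (Subgroup.commutator_le.mpr ?_)
        (isClosed_map_subtype_comap hΔclosed Φ hΦc _)
      intro g₁ hg₁ g₂ hg₂
      refine ⟨⁅(⟨g₁, hg₁⟩ : D.DeltaHat), ⟨g₂, hg₂⟩⁆, ?_, rfl⟩
      rw [SetLike.mem_coe, Subgroup.mem_comap, map_commutatorElement]
      exact Subgroup.commutator_mem_commutator ⟨_, rfl⟩ ⟨_, rfl⟩
    exact mem_of_coe_mem_map_subtype_comap Φ _ (hle hc)
  obtain ⟨e, he⟩ := Subgroup.mem_zpowers_iff.mp (hcyc hcA)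
  -- `F` kills `[[Δ_X,Δ_X],Δ_X]⁻`, hence `F c ^ n = 1`
  have hFcn : F (⟨c, hcΔ⟩ ^ n) = 1 := by
    have hle : (⁅⁅D.DeltaHat, D.DeltaHat⁆, D.DeltaHat⁆).topologicalClosure ≤
        (((⊥ : Subgroup ((D.PiHat ⧸ M') × CocycleExtension f)).comap Φ).map D.DeltaHat.subtype :
          Subgroup D.PiHat) := by
      refine Subgroup.topologicalClosure_minimal _ ?_ (isClosed_map_subtype_comap hΔclosed Φ hΦc _)
      intro g hg
      have hgΔ : g ∈ D.DeltaHat := D.tripleCommutatorClosure_le_deltaHat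
        (Subgroup.le_topologicalClosure _ hg)
      refine ⟨⟨g, hgΔ⟩, ?_, rfl⟩
      rw [SetLike.mem_coe, Subgroup.mem_comap, Subgroup.mem_bot]
      exact hker3 ⟨g, hgΔ⟩ hg
    have hmem : (((⟨c, hcΔ⟩ : D.DeltaHat) ^ n : D.DeltaHat) : D.PiHat) ∈
        (((⊥ : Subgroup ((D.PiHat ⧸ M') × CocycleExtension f)).comap Φ).map D.DeltaHat.subtype :
          Subgroup D.PiHat) := by
      rw [Subgroup.coe_pow]
      exact hle hcn
    have h := mem_of_coe_mem_map_subtype_comap Φ ⊥ hmem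
    rw [Subgroup.mem_bot] at h
    have h2 := congrArg Prod.snd h
    rwa [hΦ_snd, Prod.snd_one] at h2
  -- (4) order bookkeeping: `[x, y]^(e n) = 1` forces `#(Π_X/M') ∣ e`
  have hFc : F ⟨c, hcΔ⟩ = (⁅x, y⁆ : CocycleExtension f) ^ e := by
    have h2 := congrArg Prod.snd he
    rw [hsnd, hcomm_snd, hΦ_snd, hΦ_snd, hΦ_snd, hFa, hFb] at h2
    exact h2.symm
  have hdvd : (Nat.card (D.PiHat ⧸ M') : ℤ) ∣ e := by
    have h1 : ((⁅x, y⁆ : CocycleExtension f) ^ e) ^ (n : ℤ) = 1 := by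
      rw [← hFc, zpow_natCast, ← map_pow, hFcn]
    have hn' : (n : ℤ) ≠ 0 := by exact_mod_cast hn
    rw [← zpow_mul, ← orderOf_dvd_iff_zpow_eq_one, horder, Nat.cast_mul, mul_comm e] at h1
    exact (mul_dvd_mul_iff_left hn').mp h1
  obtain ⟨k, hk⟩ := hdvd
  -- conclusion: `c ≡ [ā, b̄]^e ≡ 1 mod M'`
  have h1c : QuotientGroup.mk' M' c = 1 := by
    have h1 := congrArg Prod.fst he
    rw [hfst, hcomm_fst, hΦ_fst, hk, zpow_mul, zpow_natCast, pow_card_eq_one', one_zpow] at h1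
    exact h1.symm
  exact (QuotientGroup.eq_one_iff c).mp h1c

/-- **`Δ_Θ` is torsion-free** ("`(Ẑ(1) ≅) Δ_Θ`", p. 12): under the freeness guard, an element of
`Δ_Θ = Ker((Π^tp_X)^Θ ↠ (Π^tp_X)^ell)` killed by some `n ≥ 1` is trivial — the tempered `Δ_Θ` embeds in
`[Δ_X,Δ_X]⁻/[[Δ_X,Δ_X],Δ_X]⁻` (the printed kernels of `Setting.lean`), which is torsion-free.
[cite: MochizukiEtTh2009, §1 p.12] -/
theorem deltaTheta_torsionfree (hO : D.IsEtThOrigin) {t : D.GtpTheta} (ht : t ∈ D.DeltaTheta)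
    {n : ℕ} (hn : n ≠ 0) (htn : t ^ n = 1) : t = 1 := by
  obtain ⟨g, rfl⟩ := D.toTheta_surjective t
  have hg : g ∈ (D.thetaToEll.comp D.toTheta).ker := ht
  rw [D.ker_toEll, Subgroup.mem_comap] at hg
  have hgn : g ^ n ∈ D.toTheta.ker := by
    rw [MonoidHom.mem_ker, map_pow, htn]
  rw [D.ker_toTheta, Subgroup.mem_comap, map_pow] at hgn
  have hmem := D.mem_tripleCommutatorClosure_of_pow_mem hO hg hn hgn
  have : g ∈ D.toTheta.ker := by
    rw [D.ker_toTheta, Subgroup.mem_comap]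
    exact hmem
  exact this

/-- `Δ_Θ` has no `2`-torsion (the case used by the §2 rigidity chain). [cite: MochizukiEtTh2009, §1 p.12] -/
theorem deltaTheta_eq_one_of_sq_eq_one (hO : D.IsEtThOrigin) {t : D.GtpTheta} (ht : t ∈ D.DeltaTheta)
    (h2 : t ^ 2 = 1) : t = 1 :=
  D.deltaTheta_torsionfree hO ht two_ne_zero h2

/-- **The `2`-torsion binder `H2` of the §2 rigidity chain is a theorem under the guard**: for EVERY
single-level identification `μ : (l·Δ_Θ) ↠ μ_N` (`CyclotomeMod`, abc-iut-L2-t8) and every `t ∈ l·Δ_Θ` with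
`t² = 1` one has `red t = 1` — indeed `t = 1` by `deltaTheta_torsionfree`. This is the hypothesis `H2` of
`Discharge/Sec2GalExtensionProofs.lean` (seat abc-iut-L2-t10; there: not derivable from `Setting` v3 +
`CyclotomeMod` alone). [cite: MochizukiEtTh2009, Prop 2.14 (ii) p.49] -/
theorem CyclotomeMod.red_eq_one_of_sq_eq_one_of_origin {l : ℕ} {N : ℕ+} (μ : D.CyclotomeMod l N)
    (hO : D.IsEtThOrigin) (t : D.lDeltaTheta l) (ht : t ^ 2 = 1) : μ.red t = 1 := by
  have h1 : (t : D.GtpTheta) = 1 := by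
    refine D.deltaTheta_eq_one_of_sq_eq_one hO (D.lDeltaTheta_le l t.2) ?_
    rw [← Subgroup.coe_pow, ht, Subgroup.coe_one]
  have ht1 : t = 1 := Subtype.ext h1
  rw [ht1, map_one]

end ThetaSetting

end Literature.AnabelianGeometry.EtaleTheta

end
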